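import Summits.Ventures.PercRepro.Night2FatZPlanes

/-!
# night-2: each plane of the two-planes regime carries at least three points of `H₀` off the spine

Regime data: a line `R₁` of `≥ 3` points of `H₀ = (G ∖ K) ∖ {w₀, x}` coplanar with the off-points, two points
`c₂ ∉ clF R₁`, `c₃ ∉ clF (insert c₂ R₁)` of `H₀`, and `H₀ ⊆ π₂ ∪ π₃` (`π_i = clF (insert c_i R₁)`).  Let
`M = H₀ ∩ π₃ ∖ clF R₁` be the points of `π₃` off the spine.  The hyperplane `Hyp = clF {k, w₀, s₁, s₂, c₂}`
(`k` the coloop, `s₁ ≠ s₂` on the spine) contains everything but `M` (`sdiff_clF_eq_side`): `x ∈ cl (π₂ ∪ {w₀})`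
by submodularity, and a point of `H₀` in `Hyp` lies in `π₂` (the rank-`4` flat `Hyp ∩ clF B₀` is `cl (π₂ ∪ K)`).
Hence `|M| ≥ 2` (`two_le_card_side`: a single point off `Hyp` would be a coloop of `G`) and, under the single fat
closure hypothesis, `|M| ≥ 3` (`three_le_card_side_of_fat`: with `|M| = 2` the five points `k, w₀, s₁, s₂, c₂`
form a thin member — their complement contains `c₃, m, a spine point off the line c₃m, x` and a second point of
`π₂` off the spine, of rank `5` — whose closure `Hyp` is a SECOND fat closure).  The symmetric statements for
`π₂` follow by exchanging `c₂, c₃`.  Paper `proofs/NIGHT-2-g34.md` §6′ (e).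
-/

namespace PercRepro.Shadow

open PercRepro.ThmH PercRepro.PerFlat

variable {α : Type*} [DecidableEq α] {M : Matroid α} [M.Finite] {G : Finset α}

/-- **A five-point set of rank `5` containing the coloop whose complement spans `G ∖ K` is a thin member** (when its
closure misses `≠ 1` points of `G`): the complement of a thin member `B₀` spans the whole matroid, so the rank of
`(G ∖ K) ∪ (gr ∖ G)` is `7`, and `G ∖ B'` spans `G ∖ K`. -/
theorem mem_thinMembers_of_rkN_five (hG : G ∈ flatsQ M (5 + 1)) (hd : (gr M \ G).card = 2)
    (hk : kColoops M G = 1) {B₀ : Finset α} (hB₀ : B₀ ∈ thinMembers M 5 G)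
    {B' : Finset α} (hB'G : B' ⊆ G) (hKB' : coloops M G ⊆ B') (hr : rkN M B' = 5)
    (hc : rkN M (G \ B') = 5) (hnl : (G \ clF M B').card ≠ 1) : B' ∈ thinMembers M 5 G := by
  have hGg : G ⊆ gr M := (mem_flatsQ.1 hG).1
  have hd' : (gr M \ G).card ≤ 5 := by omega
  have hKB₀ : coloops M G ⊆ B₀ := coloops_subset_of_mem_thinMembers hG hd' hB₀
  have hG6 : rkN M G = 5 + 1 := rkN_eq_of_mem_flatsQ hG
  obtain ⟨k, hkK⟩ : ∃ k, coloops M G = {k} := by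
    rw [kColoops_eq_card_coloops] at hk
    exact Finset.card_eq_one.1 hk
  have hkc : k ∈ coloops M G := by rw [hkK]; exact Finset.mem_singleton_self k
  have hkG : k ∈ G := (mem_coloops.1 hkc).1
  have hkcl : k ∉ clF M (G.erase k) := (mem_coloops.1 hkc).2
  have hrk5 : rkN M (G.erase k) = 5 := by
    have h1 := rkN_insert_of_notMem_clF (hGg hkG) hkcl
    rw [Finset.insert_erase hkG, hG6] at h1
    omega
  have herg : G.erase k ⊆ gr M := (Finset.erase_subset _ _).trans hGg
  -- `Z₀ = (G ∖ K) ∪ (gr ∖ G)` has rank `7`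
  set Z₀ := G.erase k ∪ (gr M \ G) with hZ₀
  have hZ₀le : rkN M Z₀ ≤ 7 := by
    obtain ⟨o₁, o₂, -, hoo⟩ := Finset.card_eq_two.1 hd
    have : Z₀ = insert o₁ (insert o₂ (G.erase k)) := by
      rw [hZ₀, hoo]
      ext e
      simp only [Finset.mem_union, Finset.mem_insert, Finset.mem_singleton]
      tauto
    rw [this]
    have h1 := rkN_insert_le_succ (M := M) (insert o₂ (G.erase k)) o₁
    have h2 := rkN_insert_le_succ (M := M) (G.erase k) o₂
    omega
  have h7 : rkN M (gr M \ B₀) = 7 := by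
    have := (mem_Uq.1 (mem_membersIn.1 (mem_thinMembers.1 hB₀).1).1).2.2
    rw [eRk_eq_rkN] at this
    exact_mod_cast this
  have hmemZ : ∀ {B'' : Finset α}, coloops M G ⊆ B'' → gr M \ B'' ⊆ Z₀ := by
    intro B'' hKB'' e he
    rw [Finset.mem_sdiff] at he
    rw [hZ₀, Finset.mem_union, Finset.mem_erase, Finset.mem_sdiff]
    by_cases heG : e ∈ G
    · exact Or.inl ⟨fun h' => he.2 (h' ▸ hKB'' hkc), heG⟩
    · exact Or.inr ⟨he.1, heG⟩
  have hZ₀7 : rkN M Z₀ = 7 := le_antisymm hZ₀le (h7 ▸ rkN_mono (hmemZ hKB₀))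
  -- `G ∖ B'` spans `G ∖ K`
  have hsub : G \ B' ⊆ G.erase k := fun e he =>
    Finset.mem_erase.2 ⟨fun h' => (Finset.mem_sdiff.1 he).2 (h' ▸ hKB' hkc), (Finset.mem_sdiff.1 he).1⟩
  have hcl : clF M (G \ B') = clF M (G.erase k) :=
    clF_eq_clF_of_subset_clF_of_rkN_le herg (hsub.trans (subset_clF_of_subset_gr herg)) (by omega)
  have hZ₀cl : Z₀ ⊆ clF M (gr M \ B') := by
    intro e he
    rw [hZ₀, Finset.mem_union] at he
    rcases he with he | he
    · have : e ∈ clF M (G \ B') := by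
        rw [hcl]
        exact subset_clF_of_subset_gr herg he
      exact clF_mono (Finset.sdiff_subset_sdiff hGg (Finset.Subset.refl _)) this
    · exact subset_clF_of_subset_gr Finset.sdiff_subset
        (Finset.mem_sdiff.2 ⟨(Finset.mem_sdiff.1 he).1, fun h' => (Finset.mem_sdiff.1 he).2 (hB'G h')⟩)
  have h7' : rkN M (gr M \ B') = 7 := by
    apply le_antisymm ((rkN_mono (hmemZ hKB')).trans hZ₀le)
    calc 7 = rkN M Z₀ := hZ₀7.symm
      _ ≤ rkN M (clF M (gr M \ B')) := rkN_mono hZ₀cl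
      _ = rkN M (gr M \ B') := rkN_clF _
  have hUq : B' ∈ Uq M (5 + 2) 5 := by
    rw [mem_Uq]
    refine ⟨hB'G.trans hGg, ?_, ?_⟩
    · rw [eRk_eq_rkN, hr]
    · rw [eRk_eq_rkN, h7']
  rw [mem_thinMembers]
  refine ⟨mem_membersIn.2 ⟨hUq, clF_subset_of_subset_flatsQ hG hB'G⟩, ?_⟩
  rw [mem_lay0]
  rintro ⟨-, h1, -⟩
  exact hnl h1

/-- **The rank of `{k, w₀, s₁, s₂, c₂}` is `5`** (`s₁ ≠ s₂` on the spine, `c₂` off it, `w₀` off the fat closure,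
`k` the coloop). -/
theorem rkN_side_member_eq_five (hG : G ∈ flatsQ M (5 + 1)) (hd : (gr M \ G).card = 2)
    (hs : ∀ e ∈ gr M, ∀ f ∈ gr M, e ≠ f → rkN M {e, f} = 2)
    {B₀ : Finset α} (hB₀ : B₀ ∈ thinMembers M 5 G) {w₀ x : α} (hD : G \ clF M B₀ = {w₀, x})
    {R₁ : Finset α} (hR₁V : R₁ ⊆ (G \ coloops M G) \ {w₀, x}) (hR₁2 : rkN M R₁ = 2) {c₂ : α}
    (hc₂V : c₂ ∈ (G \ coloops M G) \ {w₀, x}) (hc₂ : c₂ ∉ clF M R₁)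
    {k : α} (hkK : coloops M G = {k}) {s₁ s₂ : α} (hs₁ : s₁ ∈ R₁) (hs₂ : s₂ ∈ R₁) (hs12 : s₁ ≠ s₂) :
    rkN M (insert k (insert w₀ (insert s₁ (insert s₂ {c₂})))) = 5 := by
  have hGg : G ⊆ gr M := (mem_flatsQ.1 hG).1
  have hd' : (gr M \ G).card ≤ 5 := by omega
  have hKB₀ : coloops M G ⊆ B₀ := coloops_subset_of_mem_thinMembers hG hd' hB₀
  have hB₀G : B₀ ⊆ G := subset_G_of_mem_thinMembers hB₀
  have hkc : k ∈ coloops M G := by rw [hkK]; exact Finset.mem_singleton_self k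
  have hkG : k ∈ G := (mem_coloops.1 hkc).1
  have hkcl : k ∉ clF M (G.erase k) := (mem_coloops.1 hkc).2
  have hVg : (G \ coloops M G) \ {w₀, x} ⊆ gr M := fun e he =>
    hGg (Finset.mem_sdiff.1 (Finset.mem_sdiff.1 he).1).1
  have hVB₀ : (G \ coloops M G) \ {w₀, x} ⊆ clF M B₀ := by
    intro e he
    by_contra he'
    have : e ∈ G \ clF M B₀ :=
      Finset.mem_sdiff.2 ⟨(Finset.mem_sdiff.1 (Finset.mem_sdiff.1 he).1).1, he'⟩
    rw [hD] at this
    exact (Finset.mem_sdiff.1 he).2 this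
  have hVk : (G \ coloops M G) \ {w₀, x} ⊆ G.erase k := fun e he =>
    Finset.mem_erase.2 ⟨fun h' => (Finset.mem_sdiff.1 (Finset.mem_sdiff.1 he).1).2 (h' ▸ hkc),
      (Finset.mem_sdiff.1 (Finset.mem_sdiff.1 he).1).1⟩
  have hw₀D : w₀ ∈ G ∧ w₀ ∉ clF M B₀ := by
    have : w₀ ∈ G \ clF M B₀ := by rw [hD]; exact Finset.mem_insert_self _ _
    exact Finset.mem_sdiff.1 this
  have hR₁g : R₁ ⊆ gr M := hR₁V.trans hVg
  have hc₂g : c₂ ∈ gr M := hVg hc₂V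
  set X₀ : Finset α := insert s₁ (insert s₂ {c₂}) with hX₀
  have hX₀g : X₀ ⊆ gr M := by
    intro e he
    simp only [hX₀, Finset.mem_insert, Finset.mem_singleton] at he
    rcases he with rfl | rfl | rfl
    · exact hR₁g hs₁
    · exact hR₁g hs₂
    · exact hc₂g
  have hX₀V : X₀ ⊆ (G \ coloops M G) \ {w₀, x} := by
    intro e he
    simp only [hX₀, Finset.mem_insert, Finset.mem_singleton] at he
    rcases he with rfl | rfl | rfl
    · exact hR₁V hs₁
    · exact hR₁V hs₂
    · exact hc₂V
  have hπ₂3 : rkN M (insert c₂ R₁) = 3 := by rw [rkN_insert_of_notMem_clF hc₂g hc₂, hR₁2]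
  have hR₁X₀ : R₁ ⊆ clF M X₀ :=
    subset_clF_of_rkN_le_two_of_two_mem hs hR₁g (by omega) hs₁ hs₂ hs12
      (subset_clF_of_subset_gr hX₀g (Finset.mem_insert_self _ _))
      (subset_clF_of_subset_gr hX₀g (Finset.mem_insert_of_mem (Finset.mem_insert_self _ _)))
  have hX₀cl : clF M X₀ = clF M (insert c₂ R₁) := by
    symm
    apply clF_eq_clF_of_subset_clF_of_rkN_le hX₀g
    · exact Finset.insert_subset (subset_clF_of_subset_gr hX₀g
        (Finset.mem_insert_of_mem (Finset.mem_insert_of_mem (Finset.mem_singleton_self _)))) hR₁X₀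
    · rw [hπ₂3]
      calc rkN M X₀ ≤ X₀.card := rkN_le_card _
        _ ≤ 3 := by
          rw [hX₀]
          exact (Finset.card_insert_le _ _).trans (Nat.succ_le_succ (Finset.card_insert_le _ _))
  have hX₀3 : rkN M X₀ = 3 := by rw [← rkN_clF, hX₀cl, rkN_clF, hπ₂3]
  have hw₀X₀ : w₀ ∉ clF M X₀ := fun h' => hw₀D.2 (clF_subset_clF_of_subset_clF (hX₀V.trans hVB₀) h')
  have hkX₀ : k ∉ clF M X₀ := fun h'' => hkcl (clF_mono (hX₀V.trans hVk) h'')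
  have hk' : k ∉ clF M (insert w₀ X₀) := by
    intro h'
    have h1 : rkN M (insert w₀ X₀) = 4 := by
      rw [rkN_insert_of_notMem_clF (hGg hw₀D.1) hw₀X₀, hX₀3]
    have h2 : rkN M (insert k X₀) = 4 := by rw [rkN_insert_of_notMem_clF (hGg hkG) hkX₀, hX₀3]
    have h3 : rkN M (insert k (insert w₀ X₀)) = 4 := by
      have := rkN_mono (M := M) (X := insert k (insert w₀ X₀)) (Y := clF M (insert w₀ X₀))
        (Finset.insert_subset h' (subset_clF_of_subset_gr (Finset.insert_subset (hGg hw₀D.1) hX₀g)))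
      rw [rkN_clF, h1] at this
      have := rkN_mono (M := M) (Finset.subset_insert k (insert w₀ X₀))
      omega
    have hw₀cl : w₀ ∈ clF M (insert k X₀) := by
      have hsub' : insert k X₀ ⊆ insert k (insert w₀ X₀) :=
        Finset.insert_subset_insert _ (Finset.subset_insert _ _)
      exact mem_clF_of_rkN_eq hsub' (Finset.insert_subset (hGg hkG)
        (Finset.insert_subset (hGg hw₀D.1) hX₀g)) (by omega)
        (Finset.mem_insert_of_mem (Finset.mem_insert_self _ _))
    exact hw₀D.2 (clF_subset_clF_of_subset_clF (Finset.insert_subset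
      (subset_clF_of_subset_gr (hB₀G.trans hGg) (hKB₀ hkc)) (hX₀V.trans hVB₀)) hw₀cl)
  rw [rkN_insert_of_notMem_clF (hGg hkG) hk', rkN_insert_of_notMem_clF (hGg hw₀D.1) hw₀X₀, hX₀3]

/-- **The hyperplane `clF {k, w₀, s₁, s₂, c₂}` misses exactly the points of `π₃` off the spine.** -/
theorem sdiff_clF_eq_side (hG : G ∈ flatsQ M (5 + 1)) (hd : (gr M \ G).card = 2)
    (hs : ∀ e ∈ gr M, ∀ f ∈ gr M, e ≠ f → rkN M {e, f} = 2)
    {B₀ : Finset α} (hB₀ : B₀ ∈ thinMembers M 5 G) {w₀ x : α} (hD : G \ clF M B₀ = {w₀, x})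
    {R₁ : Finset α} (hR₁V : R₁ ⊆ (G \ coloops M G) \ {w₀, x}) (hR₁2 : rkN M R₁ = 2)
    (hcop : rkN M (insert w₀ (insert x R₁)) ≤ 3) {c₂ c₃ : α}
    (hc₂V : c₂ ∈ (G \ coloops M G) \ {w₀, x}) (hc₃V : c₃ ∈ (G \ coloops M G) \ {w₀, x})
    (hc₂ : c₂ ∉ clF M R₁) (hc₃ : c₃ ∉ clF M (insert c₂ R₁))
    (hcover : ∀ e ∈ (G \ coloops M G) \ {w₀, x}, e ∈ clF M (insert c₂ R₁) ∨ e ∈ clF M (insert c₃ R₁))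
    {k : α} (hkK : coloops M G = {k}) {s₁ s₂ : α} (hs₁ : s₁ ∈ R₁) (hs₂ : s₂ ∈ R₁) (hs12 : s₁ ≠ s₂) :
    G \ clF M (insert k (insert w₀ (insert s₁ (insert s₂ {c₂})))) =
      ((G \ coloops M G) \ {w₀, x}).filter (fun e => e ∈ clF M (insert c₃ R₁) ∧ e ∉ clF M R₁) := by
  have hGg : G ⊆ gr M := (mem_flatsQ.1 hG).1
  have hd' : (gr M \ G).card ≤ 5 := by omega
  have hKB₀ : coloops M G ⊆ B₀ := coloops_subset_of_mem_thinMembers hG hd' hB₀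
  have hB₀G : B₀ ⊆ G := subset_G_of_mem_thinMembers hB₀
  have hkc : k ∈ coloops M G := by rw [hkK]; exact Finset.mem_singleton_self k
  have hkG : k ∈ G := (mem_coloops.1 hkc).1
  have hkcl : k ∉ clF M (G.erase k) := (mem_coloops.1 hkc).2
  have hVg : (G \ coloops M G) \ {w₀, x} ⊆ gr M := fun e he =>
    hGg (Finset.mem_sdiff.1 (Finset.mem_sdiff.1 he).1).1
  have hVB₀ : (G \ coloops M G) \ {w₀, x} ⊆ clF M B₀ := by
    intro e he
    by_contra he'
    have : e ∈ G \ clF M B₀ :=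
      Finset.mem_sdiff.2 ⟨(Finset.mem_sdiff.1 (Finset.mem_sdiff.1 he).1).1, he'⟩
    rw [hD] at this
    exact (Finset.mem_sdiff.1 he).2 this
  have hVk : (G \ coloops M G) \ {w₀, x} ⊆ G.erase k := fun e he =>
    Finset.mem_erase.2 ⟨fun h' => (Finset.mem_sdiff.1 (Finset.mem_sdiff.1 he).1).2 (h' ▸ hkc),
      (Finset.mem_sdiff.1 (Finset.mem_sdiff.1 he).1).1⟩
  have hoffD : ∀ e, e ∈ ({w₀, x} : Finset α) → e ∈ G ∧ e ∉ clF M B₀ := by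
    intro e he
    rw [← hD] at he
    exact Finset.mem_sdiff.1 he
  have hw₀D := hoffD w₀ (Finset.mem_insert_self _ _)
  have hxD := hoffD x (Finset.mem_insert_of_mem (Finset.mem_singleton_self _))
  have hR₁g : R₁ ⊆ gr M := hR₁V.trans hVg
  have hc₂g : c₂ ∈ gr M := hVg hc₂V
  have hs₁g : s₁ ∈ gr M := hR₁g hs₁
  have hs₂g : s₂ ∈ gr M := hR₁g hs₂
  have hc₂R : c₂ ∉ R₁ := fun h' => hc₂ (subset_clF_of_subset_gr hR₁g h')
  set X₀ : Finset α := insert s₁ (insert s₂ {c₂}) with hX₀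
  set B' : Finset α := insert k (insert w₀ X₀) with hB'
  have hX₀g : X₀ ⊆ gr M := by
    intro e he
    simp only [hX₀, Finset.mem_insert, Finset.mem_singleton] at he
    rcases he with rfl | rfl | rfl
    · exact hs₁g
    · exact hs₂g
    · exact hc₂g
  have hX₀V : X₀ ⊆ (G \ coloops M G) \ {w₀, x} := by
    intro e he
    simp only [hX₀, Finset.mem_insert, Finset.mem_singleton] at he
    rcases he with rfl | rfl | rfl
    · exact hR₁V hs₁
    · exact hR₁V hs₂
    · exact hc₂V
  have hX₀B' : X₀ ⊆ B' := (Finset.subset_insert _ _).trans (Finset.subset_insert _ _)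
  -- `clF X₀ = clF (insert c₂ R₁)` (the plane `π₂`)
  have hπ₂3 : rkN M (insert c₂ R₁) = 3 := by rw [rkN_insert_of_notMem_clF hc₂g hc₂, hR₁2]
  have hR₁X₀ : R₁ ⊆ clF M X₀ :=
    subset_clF_of_rkN_le_two_of_two_mem hs hR₁g (by omega) hs₁ hs₂ hs12
      (subset_clF_of_subset_gr hX₀g (Finset.mem_insert_self _ _))
      (subset_clF_of_subset_gr hX₀g (Finset.mem_insert_of_mem (Finset.mem_insert_self _ _)))
  have hX₀cl : clF M X₀ = clF M (insert c₂ R₁) := by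
    symm
    apply clF_eq_clF_of_subset_clF_of_rkN_le hX₀g
    · exact Finset.insert_subset (subset_clF_of_subset_gr hX₀g
        (Finset.mem_insert_of_mem (Finset.mem_insert_of_mem (Finset.mem_singleton_self _)))) hR₁X₀
    · rw [hπ₂3]
      calc rkN M X₀ ≤ X₀.card := rkN_le_card _
        _ ≤ 3 := by
          rw [hX₀]
          exact (Finset.card_insert_le _ _).trans (Nat.succ_le_succ (Finset.card_insert_le _ _))
  have hπ₂B' : clF M (insert c₂ R₁) ⊆ clF M B' := by
    rw [← hX₀cl]
    exact clF_mono hX₀B'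
  have hX₀3 : rkN M X₀ = 3 := by rw [← rkN_clF, hX₀cl, rkN_clF, hπ₂3]
  -- `x ∈ clF B'`: the line `R₁` is coplanar with `w₀, x`
  have hw₀π₂ : w₀ ∉ clF M (insert c₂ R₁) := fun h' =>
    hw₀D.2 (clF_subset_clF_of_subset_clF (Finset.insert_subset (hVB₀ hc₂V) (hR₁V.trans hVB₀)) h')
  have h4 : rkN M (insert w₀ (insert c₂ R₁)) = 4 := by
    rw [rkN_insert_of_notMem_clF (hGg hw₀D.1) hw₀π₂, hπ₂3]
  have hxB' : x ∈ clF M B' := by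
    have hsub := rkN_inter_clF_add_le (M := M) (X := insert c₂ R₁) (Y := insert w₀ (insert x R₁))
      (Finset.insert_subset hc₂g hR₁g)
      (Finset.insert_subset (hGg hw₀D.1) (Finset.insert_subset (hGg hxD.1) hR₁g))
    have hR₁int : R₁ ⊆ clF M (insert c₂ R₁) ∩ clF M (insert w₀ (insert x R₁)) := by
      intro e he
      exact Finset.mem_inter.2 ⟨subset_clF_of_subset_gr (Finset.insert_subset hc₂g hR₁g)
        (Finset.mem_insert_of_mem he), subset_clF_of_subset_gr
        (Finset.insert_subset (hGg hw₀D.1) (Finset.insert_subset (hGg hxD.1) hR₁g))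
        (Finset.mem_insert_of_mem (Finset.mem_insert_of_mem he))⟩
    have h2 := rkN_mono (M := M) hR₁int
    have hU : insert w₀ (insert c₂ R₁) ⊆ insert c₂ R₁ ∪ insert w₀ (insert x R₁) := by
      intro e he
      rw [Finset.mem_insert] at he
      rw [Finset.mem_union]
      rcases he with rfl | he
      · exact Or.inr (Finset.mem_insert_self _ _)
      · exact Or.inl he
    have h3 := rkN_mono (M := M) hU
    have hxU : x ∈ insert c₂ R₁ ∪ insert w₀ (insert x R₁) :=
      Finset.mem_union_right _ (Finset.mem_insert_of_mem (Finset.mem_insert_self _ _))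
    have hxcl : x ∈ clF M (insert w₀ (insert c₂ R₁)) :=
      mem_clF_of_rkN_eq hU (Finset.union_subset (Finset.insert_subset hc₂g hR₁g)
        (Finset.insert_subset (hGg hw₀D.1) (Finset.insert_subset (hGg hxD.1) hR₁g))) (by omega) hxU
    refine clF_subset_clF_of_subset_clF ?_ hxcl
    exact Finset.insert_subset (subset_clF_of_subset_gr (hB'.symm ▸ Finset.insert_subset (hGg hkG)
      (Finset.insert_subset (hGg hw₀D.1) hX₀g)) (Finset.mem_insert_of_mem (Finset.mem_insert_self _ _)))
      ((Finset.insert_subset (subset_clF_of_subset_gr hX₀g (Finset.mem_insert_of_mem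
        (Finset.mem_insert_of_mem (Finset.mem_singleton_self _)))) hR₁X₀).trans (clF_mono hX₀B'))
  have hB'g : B' ⊆ gr M :=
    Finset.insert_subset (hGg hkG) (Finset.insert_subset (hGg hw₀D.1) hX₀g)
  ext e
  rw [Finset.mem_sdiff, Finset.mem_filter]
  constructor
  · rintro ⟨heG, hecl⟩
    have hek : e ≠ k := fun h' => hecl (h' ▸ subset_clF_of_subset_gr hB'g (Finset.mem_insert_self _ _))
    have hew : e ≠ w₀ := fun h' => hecl (h' ▸ subset_clF_of_subset_gr hB'g
      (Finset.mem_insert_of_mem (Finset.mem_insert_self _ _)))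
    have hex : e ≠ x := fun h' => hecl (h' ▸ hxB')
    have heV : e ∈ (G \ coloops M G) \ {w₀, x} := by
      rw [Finset.mem_sdiff, Finset.mem_sdiff, hkK, Finset.mem_singleton, Finset.mem_insert,
        Finset.mem_singleton]
      exact ⟨⟨heG, hek⟩, by rintro (h' | h') <;> [exact hew h'; exact hex h']⟩
    refine ⟨heV, ?_, fun h' => hecl (hπ₂B' (clF_mono (Finset.subset_insert _ _) h'))⟩
    rcases hcover e heV with h' | h'
    · exact absurd (hπ₂B' h') hecl
    · exact h'
  · rintro ⟨heV, heπ₃, heR₁⟩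
    refine ⟨(Finset.mem_sdiff.1 (Finset.mem_sdiff.1 heV).1).1, fun hecl => ?_⟩
    -- `e ∈ clF B' ∩ clF B₀ ⊆ clF (insert k X₀)`, hence `e ∈ clF X₀ = π₂`, hence on the spine
    have hB'5 : rkN M B' = 5 :=
      rkN_side_member_eq_five hG hd hs hB₀ hD hR₁V hR₁2 hc₂V hc₂ hkK hs₁ hs₂ hs12
    have hB₀5 : rkN M B₀ = 5 := rkN_eq_five_of_mem_thinMembers hB₀
    have hunion : 6 ≤ rkN M (B' ∪ B₀) := by
      have h1 : rkN M (insert w₀ B₀) = 6 := by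
        rw [rkN_insert_of_notMem_clF (hGg hw₀D.1) hw₀D.2, hB₀5]
      have h2 : insert w₀ B₀ ⊆ B' ∪ B₀ := Finset.insert_subset
        (Finset.mem_union_left _ (Finset.mem_insert_of_mem (Finset.mem_insert_self _ _)))
        Finset.subset_union_right
      have := rkN_mono (M := M) h2
      omega
    have hint := rkN_inter_clF_add_le (M := M) hB'g (hB₀G.trans hGg)
    have hint4 : rkN M (clF M B' ∩ clF M B₀) ≤ 4 := by omega
    set P : Finset α := insert k X₀ with hP
    have hPg : P ⊆ gr M := Finset.insert_subset (hGg hkG) hX₀g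
    have hP4 : rkN M P = 4 := by
      have hkX₀ : k ∉ clF M X₀ := fun h'' => hkcl (clF_mono (hX₀V.trans hVk) h'')
      rw [hP, rkN_insert_of_notMem_clF (hGg hkG) hkX₀, hX₀3]
    have hPint : P ⊆ clF M B' ∩ clF M B₀ := by
      intro p hp
      rw [hP, Finset.mem_insert] at hp
      rw [Finset.mem_inter]
      rcases hp with rfl | hp
      · exact ⟨subset_clF_of_subset_gr hB'g (Finset.mem_insert_self _ _),
          subset_clF_of_subset_gr (hB₀G.trans hGg) (hKB₀ hkc)⟩
      · exact ⟨subset_clF_of_subset_gr hB'g (hX₀B' hp), hVB₀ (hX₀V hp)⟩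
    have hclP : clF M P = clF M (clF M B' ∩ clF M B₀) := by
      apply clF_eq_clF_of_subset_clF_of_rkN_le
      · exact Finset.inter_subset_left.trans (fun e' he' => mem_gr_of_mem_clF he')
      · exact hPint.trans (subset_clF_of_subset_gr
          (Finset.inter_subset_left.trans (fun e' he' => mem_gr_of_mem_clF he')))
      · omega
    have heP : e ∈ clF M P := by
      rw [hclP]
      exact subset_clF_of_subset_gr (Finset.inter_subset_left.trans (fun e' he' => mem_gr_of_mem_clF he'))
        (Finset.mem_inter.2 ⟨hecl, hVB₀ heV⟩)
    have heX₀ : e ∈ clF M X₀ := by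
      by_contra heX₀
      have heg : e ∈ gr M := hVg heV
      have h1 : rkN M (insert e X₀) = 4 := by rw [rkN_insert_of_notMem_clF heg heX₀, hX₀3]
      have h2 : rkN M (insert k (insert e X₀)) = 4 := by
        have := rkN_mono (M := M) (X := insert k (insert e X₀)) (Y := clF M P)
          (Finset.insert_subset (subset_clF_of_subset_gr hPg (Finset.mem_insert_self _ _))
            (Finset.insert_subset heP ((Finset.subset_insert _ _).trans (subset_clF_of_subset_gr hPg))))
        rw [rkN_clF, hP4] at this
        have := rkN_mono (M := M) (Finset.subset_insert k (insert e X₀))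
        omega
      have hkcl' : k ∈ clF M (insert e X₀) :=
        mem_clF_of_rkN_eq (Finset.subset_insert _ _) (Finset.insert_subset (hGg hkG)
          (Finset.insert_subset heg hX₀g)) (by omega) (Finset.mem_insert_self _ _)
      exact hkcl (clF_mono (Finset.insert_subset (hVk heV) (hX₀V.trans hVk)) hkcl')
    rw [hX₀cl] at heX₀
    exact heR₁ (mem_clF_of_mem_two_planes hR₁g hc₂g (hVg hc₃V) hc₂ hc₃ heX₀ heπ₃)

end PercRepro.Shadow
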